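import Mathlib
import HarnessLib
import Summits.Ventures.LatticeQCDFlow.Scoring.ChainMeanSquareError
import Summits.Ventures.LatticeQCDFlow.Scoring.DoeblinGreenKubo
import Summits.Ventures.LatticeQCDFlow.Scoring.SplitChainFreshPairMoments

/-!
# The mean-square error of a time average is ASYMPTOTICALLY EXACTLY `σ²_f / N`, from any start:
# `N · E_{μ₀}[(f̄_N − π f)²] → σ²_f` (the Green–Kubo / `2 τ_int`-variance)

HONEST FRAMING: exact (Metropolis-corrected) sampling algorithms for lattice gauge theory;
figures of merit are autocorrelation/cost numbers at stated couplings and volumes; no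
continuum-physics claim.

Venture `LatticeQCDFlow` (cell pub-lqcd), topic `Scoring`; FANOUT row 8 (`s0-cpn-nemc`, GEN-18).
NEW WORK of the cell, not a published result; no definition is introduced.  `κ` a Markov kernel with
invariant probability `π` minorised by it, `κ(x, ·) ≥ ε π` (`ε > 0`), `|f| ≤ C` measurable,
`f̄ = f − π f`, `γ_t = autocov κ π f̄ t = ∫ f̄ · κ^t f̄ dπ`, `σ²_f = γ_0 + 2 Σ_{t≥1} γ_t` (written as in
`Scoring/RegenerativeEstimatorSigma.lean`), `P_{μ₀}` the path law of the chain from ANY initial law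
`μ₀` (`Scoring/ChainBurnIn.lean`).  `Scoring/ChainMeanSquareError.lean` bounded the mean-square
error of the time average `f̄_N = (1/N) Σ_{i<N} f(X_i)` by `(2/ε − 1) γ_0 / N + O(1/N²)`; this file
gives the SHARP first-order term:

* `abs_autocov_le_sq_mul_pow_of_doeblin` — `|γ_t| ≤ C_{f̄}² (1 − ε/2)^t`;
* `summable_moment_autocov_of_doeblin` — `Σ_t (t+1) |γ_{t+1}| < ∞` (unnormalised: no `γ_0 ≠ 0`);
* `abs_sum_sum_chain_pair_sub_autocov_le` — from any start,
  `|Σ_{i,j<N} E_{μ₀}[f̄(X_i) f̄(X_j)] − Σ_{i,j<N} γ_{|i−j|}| ≤ 2 C_{f̄}² (1 + r)/(1 − r)²`, `r = 1 − ε/2`,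
  uniformly in `N` (the initial law is forgotten at a geometric rate);
* **`chain_mse_tendsto_greenKubo`** — `N · ∫ (f̄_N − π f)² dP_{μ₀} → σ²_f` as `N → ∞`, for EVERY
  initial law `μ₀`: the `τ_int` error bar `σ_f / √N` is asymptotically exact in mean square, not only
  an upper bound and not only in distribution (`Scoring/MarkovChainCLT.lean`).

Proof: `N · MSE_N = (1/N) Σ_{i,j<N} E_{μ₀}[f̄_i f̄_j]` (`chain_sqError_timeAverage_eq`); replace each
term by the stationary `γ_{|i−j|}` at total cost `O(1)` (`abs_chain_pair_sub_autocov_le_of_doeblin`,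
`sum_sum_max`, `sum_range_odd_mul_pow_le`); `(1/N) Σ_{i,j<N} γ_{|i−j|} = γ_0 + 2 Σ_{t<N} (1 − (t+1)/N)
γ_{t+1}` (`sum_sum_dist`) `→ γ_0 + 2 Σ_{t≥1} γ_t` (`tendsto_tauIntN`, the Fejér means of an
absolutely-first-moment-summable sequence).  Printed counterpart NAMED ONLY: Madras–Sokal 1988 §2,
eq. (2.11)–(2.13); Sokal 1996 lecture notes §2 — nothing is cited as a fact.

NOT CLAIMED: any `ε` of a concrete sampler; the `O(1/N²)` term's sharp constant; unbounded `f`.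
-/

noncomputable section

namespace Summit.Ventures.LatticeQCDFlow.Scoring

open MeasureTheory ProbabilityTheory Filter Finset Preorder Literature.Probability.MarkovChains
open scoped ENNReal Topology

variable {Ω : Type*} [MeasurableSpace Ω]
variable {κ : Kernel Ω Ω} [IsMarkovKernel κ] {π : Measure Ω} [IsProbabilityMeasure π] {ε : ℝ≥0∞}

/-- Geometric decay of the unnormalised autocovariance of a centred bounded observable:
`|γ_t| ≤ C² (1 − ε/2)^t`. -/
theorem abs_autocov_le_sq_mul_pow_of_doeblin (hπ : Kernel.Invariant κ π)
    (hmin : ∀ x {B : Set Ω}, MeasurableSet B → ε * π B ≤ κ x B) (hε0 : 0 < ε) {g : Ω → ℝ}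
    (hg : Measurable g) {C : ℝ} (hC : ∀ x, |g x| ≤ C) (hg0 : ∫ x, g x ∂π = 0) (t : ℕ) :
    |autocov κ π g t| ≤ C ^ 2 * (1 - (ε / 2).toReal) ^ t := by
  obtain ⟨-, hr0, -, -, -, -⟩ := half_const_bounds hmin hε0
  have hpt : ∀ x, |g x * (kop κ)^[t] g x| ≤ C ^ 2 * (1 - (ε / 2).toReal) ^ t := fun x => by
    have hC0 : 0 ≤ C := (abs_nonneg _).trans (hC x)
    rw [abs_mul]
    calc |g x| * |(kop κ)^[t] g x| ≤ C * ((1 - (ε / 2).toReal) ^ t * C) :=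
          mul_le_mul (hC x) (abs_iterate_kop_le_of_doeblin hπ hmin hε0 hg hC hg0 t x)
            (abs_nonneg _) hC0
      _ = C ^ 2 * (1 - (ε / 2).toReal) ^ t := by ring
  unfold autocov
  calc |∫ x, g x * (kop κ)^[t] g x ∂π| ≤ ∫ x, |g x * (kop κ)^[t] g x| ∂π :=
        abs_integral_le_integral_abs
    _ ≤ ∫ _, C ^ 2 * (1 - (ε / 2).toReal) ^ t ∂π :=
        integral_mono_of_nonneg (ae_of_all _ fun x => abs_nonneg _) (integrable_const _)
          (ae_of_all _ hpt)
    _ = C ^ 2 * (1 - (ε / 2).toReal) ^ t := by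
        rw [integral_const, smul_eq_mul, probReal_univ, one_mul]

/-- `Σ_t (t + 1) |γ_{t+1}| < ∞` for a centred bounded observable of a Doeblin chain. -/
theorem summable_moment_autocov_of_doeblin (hπ : Kernel.Invariant κ π)
    (hmin : ∀ x {B : Set Ω}, MeasurableSet B → ε * π B ≤ κ x B) (hε0 : 0 < ε) {g : Ω → ℝ}
    (hg : Measurable g) {C : ℝ} (hC : ∀ x, |g x| ≤ C) (hg0 : ∫ x, g x ∂π = 0) :
    Summable fun t : ℕ => ((t : ℝ) + 1) * |autocov κ π g (t + 1)| := by
  obtain ⟨-, hr0, hr1, -, -, -⟩ := half_const_bounds hmin hε0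
  set r := 1 - (ε / 2).toReal with hr
  have hmaj : Summable fun t : ℕ => ((t : ℝ) + 1) * (C ^ 2 * r ^ (t + 1)) := by
    have hn : ‖r‖ < 1 := by rw [Real.norm_eq_abs, abs_of_nonneg hr0]; exact hr1
    have h0 : Summable fun n : ℕ => (n : ℝ) ^ 1 * r ^ n := summable_pow_mul_geometric_of_norm_lt_one 1 hn
    have h1 : Summable fun n : ℕ => (((n + 1 : ℕ) : ℝ)) ^ 1 * r ^ (n + 1) :=
      (summable_nat_add_iff (f := fun n : ℕ => (n : ℝ) ^ 1 * r ^ n) 1).2 h0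
    refine (h1.mul_left (C ^ 2)).congr fun t => ?_
    rw [pow_one, Nat.cast_add, Nat.cast_one]
    ring
  refine Summable.of_norm_bounded hmaj fun t => ?_
  have ht : (0 : ℝ) ≤ (t : ℝ) + 1 := by positivity
  rw [Real.norm_eq_abs, abs_mul, abs_of_nonneg ht, abs_abs]
  exact mul_le_mul_of_nonneg_left
    (abs_autocov_le_sq_mul_pow_of_doeblin hπ hmin hε0 hg hC hg0 (t + 1)) ht

/-- **The initial law is forgotten at bounded total cost**: for a centred bounded `g` and ANY `μ₀`,
`|Σ_{i,j<N} E_{μ₀}[g(X_i) g(X_j)] − Σ_{i,j<N} γ_{|i−j|}| ≤ 2 C² (1 + r)/(1 − r)²`, `r = 1 − ε/2`. -/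
theorem abs_sum_sum_chain_pair_sub_autocov_le (hπ : Kernel.Invariant κ π)
    (hmin : ∀ x {B : Set Ω}, MeasurableSet B → ε * π B ≤ κ x B) (hε0 : 0 < ε) {g : Ω → ℝ}
    (hg : Measurable g) {C : ℝ} (hC : ∀ x, |g x| ≤ C) (hg0 : ∫ x, g x ∂π = 0)
    (μ₀ : Measure Ω) [IsProbabilityMeasure μ₀] (N : ℕ) :
    |(∑ i ∈ Finset.range N, ∑ j ∈ Finset.range N,
        ∫ x, g (x i) * g (x j) ∂(Kernel.trajMeasure (X := fun _ : ℕ => Ω) μ₀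
          (fun n : ℕ => κ.comap (fun h : (i : ↥(Finset.Iic n)) → Ω => h ⟨n, Finset.mem_Iic.2 le_rfl⟩)
            (measurable_pi_apply _))))
      - ∑ i ∈ Finset.range N, ∑ j ∈ Finset.range N, autocov κ π g (Nat.dist i j)|
      ≤ 2 * C ^ 2 * ((1 + (1 - (ε / 2).toReal)) / (1 - (1 - (ε / 2).toReal)) ^ 2) := by
  obtain ⟨-, hr0, hr1, -, -, -⟩ := half_const_bounds hmin hε0
  set r := 1 - (ε / 2).toReal with hr
  have hC2 : 0 ≤ 2 * C ^ 2 := by positivity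
  rw [← Finset.sum_sub_distrib]
  calc |∑ i ∈ Finset.range N, ((∑ j ∈ Finset.range N,
          ∫ x, g (x i) * g (x j) ∂(Kernel.trajMeasure (X := fun _ : ℕ => Ω) μ₀
            (fun n : ℕ => κ.comap (fun h : (i : ↥(Finset.Iic n)) → Ω => h ⟨n, Finset.mem_Iic.2 le_rfl⟩)
              (measurable_pi_apply _))))
          - ∑ j ∈ Finset.range N, autocov κ π g (Nat.dist i j))|
        ≤ ∑ i ∈ Finset.range N, |(∑ j ∈ Finset.range N,
          ∫ x, g (x i) * g (x j) ∂(Kernel.trajMeasure (X := fun _ : ℕ => Ω) μ₀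
            (fun n : ℕ => κ.comap (fun h : (i : ↥(Finset.Iic n)) → Ω => h ⟨n, Finset.mem_Iic.2 le_rfl⟩)
              (measurable_pi_apply _))))
          - ∑ j ∈ Finset.range N, autocov κ π g (Nat.dist i j)| := Finset.abs_sum_le_sum_abs _ _
    _ ≤ ∑ i ∈ Finset.range N, ∑ j ∈ Finset.range N, 2 * C ^ 2 * r ^ (max i j) := by
        refine Finset.sum_le_sum fun i _ => ?_
        rw [← Finset.sum_sub_distrib]
        refine (Finset.abs_sum_le_sum_abs _ _).trans (Finset.sum_le_sum fun j _ => ?_)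
        exact abs_chain_pair_sub_autocov_le_of_doeblin hπ hmin hε0 hg hC hg0 i j
    _ = ∑ k ∈ Finset.range N, (2 * (k : ℝ) + 1) * (2 * C ^ 2 * r ^ k) :=
        sum_sum_max (fun k => 2 * C ^ 2 * r ^ k) N
    _ = 2 * C ^ 2 * ∑ k ∈ Finset.range N, (2 * (k : ℝ) + 1) * r ^ k := by
        rw [Finset.mul_sum]
        exact Finset.sum_congr rfl fun k _ => by ring
    _ ≤ 2 * C ^ 2 * ((1 + r) / (1 - r) ^ 2) :=
        mul_le_mul_of_nonneg_left (sum_range_odd_mul_pow_le hr0 hr1 N) hC2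

/-- **THE MEAN-SQUARE ERROR OF THE TIME AVERAGE IS ASYMPTOTICALLY `σ²_f / N`, FROM ANY START.**
`κ` Markov with invariant probability `π`, `κ(x, ·) ≥ ε π` (`ε > 0`), `|f| ≤ C` measurable, `μ₀` ANY
initial law: `N · ∫ ((1/N) Σ_{i<N} f(X_i) − π f)² dP_{μ₀} → σ²_f = γ_0 + 2 Σ_{k≥1} γ_k`. -/
theorem chain_mse_tendsto_greenKubo (hπ : Kernel.Invariant κ π)
    (hmin : ∀ x {B : Set Ω}, MeasurableSet B → ε * π B ≤ κ x B) (hε0 : 0 < ε)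
    {f : Ω → ℝ} (hf : Measurable f) {C : ℝ} (hC : ∀ x, |f x| ≤ C)
    (μ₀ : Measure Ω) [IsProbabilityMeasure μ₀] :
    Tendsto (fun N : ℕ => (N : ℝ) * ∫ x, ((∑ i ∈ Finset.range N, f (x i)) / N - ∫ z, f z ∂π) ^ 2
        ∂(Kernel.trajMeasure (X := fun _ : ℕ => Ω) μ₀
          (fun n : ℕ => κ.comap (fun h : (i : ↥(Finset.Iic n)) → Ω => h ⟨n, Finset.mem_Iic.2 le_rfl⟩)
            (measurable_pi_apply _))))
      atTop (𝓝 ((∫ y, (f y - ∫ z, f z ∂π) ^ 2 ∂π)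
        + 2 * ∑' k, ∫ y, (f y - ∫ z, f z ∂π) * (kop κ)^[k + 1] (fun y => f y - ∫ z, f z ∂π) y ∂π)) := by
  set c := ∫ z, f z ∂π with hc
  obtain ⟨hg, hCg, hg0⟩ := centred_observable_bounds π hf hC
  obtain ⟨-, hr0, hr1, -, -, -⟩ := half_const_bounds hmin hε0
  set r := 1 - (ε / 2).toReal with hr
  set γ : ℕ → ℝ := fun t => autocov κ π (fun y => f y - c) t with hγ
  set B : ℝ := 2 * (2 * C) ^ 2 * ((1 + r) / (1 - r) ^ 2) with hB
  -- the target in terms of `γ`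
  have hSIG : (∫ y, (f y - c) ^ 2 ∂π) + 2 * ∑' k, ∫ y, (f y - c) * (kop κ)^[k + 1] (fun y => f y - c) y ∂π
      = γ 0 - 1 + 2 * tauInt γ := by
    simp only [hγ, tauInt, autocov, Function.iterate_zero, id_eq, sq]
    ring
  rw [hSIG]
  -- (1) the Fejér means of `γ` converge
  have hs : Tendsto (fun N : ℕ => γ 0 - 1 + 2 * tauIntN γ N) atTop (𝓝 (γ 0 - 1 + 2 * tauInt γ)) :=
    ((tendsto_tauIntN (summable_moment_autocov_of_doeblin hπ hmin hε0 hg hCg hg0)).const_mul 2).const_add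
      _
  -- (2) the remainder is `O(1/N)`
  have key : ∀ N : ℕ, N ≠ 0 →
      |(N : ℝ) * ∫ x, ((∑ i ∈ Finset.range N, f (x i)) / N - c) ^ 2
          ∂(Kernel.trajMeasure (X := fun _ : ℕ => Ω) μ₀
            (fun n : ℕ => κ.comap (fun h : (i : ↥(Finset.Iic n)) → Ω => h ⟨n, Finset.mem_Iic.2 le_rfl⟩)
              (measurable_pi_apply _)))
        - (γ 0 - 1 + 2 * tauIntN γ N)| ≤ B / N := by
    intro N hN
    have hN' : (N : ℝ) ≠ 0 := Nat.cast_ne_zero.2 hN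
    have hNpos : (0 : ℝ) < N := Nat.cast_pos.2 (Nat.pos_of_ne_zero hN)
    rw [chain_sqError_timeAverage_eq hf hC c hN]
    -- `(1/N) Σ_{i,j} γ_{|i−j|} = γ_0 − 1 + 2 τ_N(γ)`
    have hfej : (∑ i ∈ Finset.range N, ∑ j ∈ Finset.range N, γ (Nat.dist i j)) / N
        = γ 0 - 1 + 2 * tauIntN γ N := by
      rw [sum_sum_dist γ N, tauIntN]
      have h1 : ∑ t ∈ Finset.range N, (1 - ((t : ℝ) + 1) / N) * γ (t + 1)
          = (∑ t ∈ Finset.range N, ((N : ℝ) - (t + 1)) * γ (t + 1)) / N := by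
        rw [Finset.sum_div]
        refine Finset.sum_congr rfl fun t _ => ?_
        field_simp
      rw [h1]
      field_simp
      ring
    have hsplit : (N : ℝ) * ((∑ i ∈ Finset.range N, ∑ j ∈ Finset.range N,
          ∫ x, (f (x i) - c) * (f (x j) - c) ∂(Kernel.trajMeasure (X := fun _ : ℕ => Ω) μ₀
            (fun n : ℕ => κ.comap (fun h : (i : ↥(Finset.Iic n)) → Ω => h ⟨n, Finset.mem_Iic.2 le_rfl⟩)
              (measurable_pi_apply _)))) / (N : ℝ) ^ 2) - (γ 0 - 1 + 2 * tauIntN γ N)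
        = ((∑ i ∈ Finset.range N, ∑ j ∈ Finset.range N,
          ∫ x, (f (x i) - c) * (f (x j) - c) ∂(Kernel.trajMeasure (X := fun _ : ℕ => Ω) μ₀
            (fun n : ℕ => κ.comap (fun h : (i : ↥(Finset.Iic n)) → Ω => h ⟨n, Finset.mem_Iic.2 le_rfl⟩)
              (measurable_pi_apply _))))
          - ∑ i ∈ Finset.range N, ∑ j ∈ Finset.range N, γ (Nat.dist i j)) / N := by
      rw [← hfej]
      field_simp
    rw [hsplit, abs_div, abs_of_pos hNpos]
    exact div_le_div_of_nonneg_right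
      (abs_sum_sum_chain_pair_sub_autocov_le hπ hmin hε0 hg hCg hg0 μ₀ N) hNpos.le
  have herr : Tendsto (fun N : ℕ => (N : ℝ) * ∫ x, ((∑ i ∈ Finset.range N, f (x i)) / N - c) ^ 2
          ∂(Kernel.trajMeasure (X := fun _ : ℕ => Ω) μ₀
            (fun n : ℕ => κ.comap (fun h : (i : ↥(Finset.Iic n)) → Ω => h ⟨n, Finset.mem_Iic.2 le_rfl⟩)
              (measurable_pi_apply _)))
        - (γ 0 - 1 + 2 * tauIntN γ N)) atTop (𝓝 0) := by
    refine squeeze_zero_norm' ?_ (tendsto_const_div_atTop_nhds_zero_nat B)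
    filter_upwards [Filter.eventually_ne_atTop 0] with N hN
    rw [Real.norm_eq_abs]
    exact key N hN
  have hfin := herr.add hs
  simp only [sub_add_cancel, zero_add] at hfin
  exact hfin

end Summit.Ventures.LatticeQCDFlow.Scoring

end
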